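import Literature.Probability.LatticeModels.HardCoreUrsell
import Literature.Probability.LatticeModels.ProductMeasureTools

/-!
# The canonical hard-core gas of independent points: Mayer expansion, tree bounds, insertion bound

Topic `Literature/MathematicalPhysics/StatisticalMechanics` (second of three files towards the
named fact `Literature.MathematicalPhysics.KineticTheory.localGibbs_densityLLN` of `KineticTheory/HardSphereEulerProofs`; the first
is `Probability/LatticeModels/HardCoreUrsell`).

Set-up (Pulvirenti–Tsagkarogiannis 2012, §3, specialised to a hard core and written
probabilistically): finitely many labels `ι`, independent points `x_i` of a measurable space `X`
with common law `ν` (a probability measure; for hard spheres on `𝕋³`: the normalised activity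
profile `β(y) dy`), and a measurable symmetric **overlap** relation `O` on `X` (distance `< ε`).
The canonical hard-core partition function of the labels `W`, normalised by the ideal-gas one, is
the probability `Ξ(W) = ℙ(no two points labelled by W overlap)` (`hcProb`), and the canonical Gibbs
measure is `ℙ( · | no overlap)`.

* **Mayer expansion for configurations** (`efR_eq_sum_setPartitions`, from the defining identity
  of `hcUrsell`): `𝟙[no overlap in W] = ∑_{π ∈ setPartitions W} ∏_{P ∈ π} u_P(x)` with the Ursell
  weights `u_P(x) = hcUrsell (overlap graph of x) P` (`uR`), each depending only on the
  coordinates in its block (`dependsOn_uR`) and measurable (`measurable_uR`).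
* **Decorated expansions** (`integral_mul_efR_eq_sum`, `integral_mul_mul_efR_eq_sum`; PT2012 §3,
  the polymer representation on vertex sets `V ⊆ {1,…,N}`, with one or two marked particles):
  `∫ g(x_i) 𝟙[no overlap in W] = ∑_{B ∋ i} w^g(B) Ξ(W \ B)` with the **decorated activities**
  `w^g(B) = ∫ g(x_i) u_B` (`decAct`), by independence of disjoint blocks
  (`integral_mul_eq_of_dependsOn`, from `ProductMeasureTools`).
* **The tree bound** (`lintegral_mul_aU_le`, `integral_abs_uR_le`, `abs_decAct_le`; the
  tree-graph inequality of PT2012 §4 in integrated form): if `ν{y : O z y} ≤ p` for all `z` then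
  `∫ |u_B| dℙ ≤ t(#B) p^{#B-1}` with the tree numbers `t` of `HardCoreUrsell` — proved by the rooted
  recursion of `hcUrsell`, integrating out the root first (`lintegral_pi_eq_lintegral_update`) and
  factorising over the blocks (`lintegral_prod_eq_prod_lintegral`), with a marked induction
  hypothesis (`∫ 𝟙[O z x_u] |u_B| ≤ t(#B) p^{#B}`).
* **Symmetry** under relabelling (`hcProb_eq_of_card_eq`, `decAct_eq_of_card_eq`,
  `decPF_eq_of_card_eq`): `Ξ(W)`, `w^g(B)` and the decorated partition functions only depend on
  the number of labels.
* **The insertion bound** (`hcProb_insert_ge`): `Ξ(W ∪ {m}) ≥ Ξ(W) (1 - #W · p)` — conditionally on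
  a hard-core configuration the new point must avoid `#W` balls of mass `≤ p` each; with
  monotonicity (`hcProb_mono`) this pins the inverse insertion probabilities
  `Ξ(W)/Ξ(W ∪ {m}) ∈ [1, 1/(1 - #W p)]`, the positivity that replaces the abstract polymer
  (Kotecký–Preiss) machinery for this canonical hard-core gas.

## Design

Everything is stated for `Measure.pi (fun _ : ι => ν)` on `ι → X` (`ι` a `Fintype`), with real
integrals for the identities and `ℝ≥0∞` Lebesgue integrals for the inductive bound; boundedness
of the Ursell weights (`abs_uR_le`, from `hcUrsellBound`) gives all integrability. No conditional
measure is constructed: downstream, expectations under the canonical Gibbs measure are quotients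
`(∫ F 𝟙[no overlap]) / Ξ`.

## References

* E. Pulvirenti, D. Tsagkarogiannis, *Cluster expansion in the canonical ensemble*, Comm. Math.
  Phys. 316 (2012) 289–306, §3 (canonical partition function as a polymer model on vertex sets,
  activities `ζ_Λ(V)`), §4 (tree-graph bound on `ζ_Λ(V)`). [PulvirentiTsagkarogiannis2012]
* S. Friedli, Y. Velenik, *Statistical Mechanics of Lattice Systems*, CUP 2017, §5.3–5.4
  (Ursell functions; (5.13)–(5.15)). [FriedliVelenik2017]
-/

namespace Literature.MathematicalPhysics.StatisticalMechanics

open MeasureTheory ProbabilityTheory Finset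

section HardCoreCanonical

variable {ι : Type*} [Fintype ι] [DecidableEq ι] {X : Type*} [MeasurableSpace X]

/-! ### The overlap graph of a configuration and the hard-core sets -/

/-- The **overlap graph** of a configuration `x : ι → X` for the overlap relation `O`: distinct
labels whose points overlap. [folklore] -/
def overlapRel (O : X → X → Prop) (x : ι → X) : ι → ι → Prop := fun i j => i ≠ j ∧ O (x i) (x j)

/-- Decidability of the overlap graph (classical). [folklore] -/
noncomputable instance overlapRel.instDecidableRel (O : X → X → Prop) (x : ι → X) :
    DecidableRel (overlapRel O x) := fun _ _ => Classical.propDecidable _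

variable (O : X → X → Prop)

/-- The **hard-core set** of the labels `W`: configurations in which no two distinct points
labelled by `W` overlap. [folklore] -/
def hardCoreSet (W : Finset ι) : Set (ι → X) := {x | ∀ i ∈ W, ∀ j ∈ W, i ≠ j → ¬ O (x i) (x j)}

/-- The real-valued **Ursell weight** `u_B(x) = hcUrsell (overlap graph of x) B`. [folklore] -/
noncomputable def uR (x : ι → X) (B : Finset ι) : ℝ := (Literature.Probability.LatticeModels.hcUrsell (overlapRel O x) B : ℝ)

/-- The real-valued hard-core indicator `𝟙[x ∈ hardCoreSet W]`, as the cast of `edgeFreeInd`.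
[folklore] -/
noncomputable def efR (x : ι → X) (W : Finset ι) : ℝ := (Literature.Probability.LatticeModels.edgeFreeInd (overlapRel O x) W : ℝ)

variable {O}

omit [Fintype ι] [DecidableEq ι] [MeasurableSpace X] in
/-- The overlap graph is symmetric if `O` is. [folklore] -/
theorem overlapRel_symm (hO : ∀ a b, O a b → O b a) (x : ι → X) :
    ∀ i j, overlapRel O x i j → overlapRel O x j i :=
  fun _ _ h => ⟨h.1.symm, hO _ _ h.2⟩

omit [Fintype ι] [DecidableEq ι] [MeasurableSpace X] in
/-- `W` is edge-free (`IsCompatible`) in the overlap graph iff the configuration is in the hard-core set of `W`.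
[folklore] -/
theorem isCompatible_overlapRel_iff (x : ι → X) (W : Finset ι) :
    Literature.Probability.LatticeModels.IsCompatible (overlapRel O x) W ↔ x ∈ hardCoreSet O W := by
  rw [Literature.Probability.LatticeModels.isCompatible_iff']
  simp only [overlapRel, hardCoreSet, Set.mem_setOf_eq, not_and]
  exact forall₂_congr fun i _ => forall₂_congr fun j _ =>
    ⟨fun h hij => h hij hij, fun h hij _ => h hij⟩

omit [Fintype ι] [MeasurableSpace X] in
/-- `efR` is the indicator of the hard-core set. [folklore] -/
theorem efR_eq_indicator (x : ι → X) (W : Finset ι) :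
    efR O x W = (hardCoreSet O W).indicator 1 x := by
  unfold efR Literature.Probability.LatticeModels.edgeFreeInd
  split_ifs with h
  · rw [Set.indicator_of_mem ((isCompatible_overlapRel_iff x W).1 h)]; simp
  · rw [Set.indicator_of_notMem (fun h' => h ((isCompatible_overlapRel_iff x W).2 h'))]; simp

omit [Fintype ι] [MeasurableSpace X] in
/-- The Möbius recursion at the real level. [folklore] -/
theorem uR_eq (x : ι → X) (B : Finset ι) :
    uR O x B = efR O x B - ∑ π ∈ (Literature.Probability.LatticeModels.setPartitions B).erase {B}, ∏ P ∈ π, uR O x P := by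
  unfold uR efR
  rw [Literature.Probability.LatticeModels.hcUrsell_eq]
  push_cast
  rfl

omit [Fintype ι] [MeasurableSpace X] in
/-- **The Mayer identity for configurations**:
`𝟙[x ∈ hardCoreSet W] = ∑_{π ∈ setPartitions W} ∏_{P ∈ π} u_P(x)`. [cite: FriedliVelenik2017, §5.3, proof of Prop. 5.3] -/
theorem efR_eq_sum_setPartitions (x : ι → X) (W : Finset ι) :
    efR O x W = ∑ π ∈ Literature.Probability.LatticeModels.setPartitions W, ∏ P ∈ π, uR O x P := by
  unfold uR efR
  rw [← Literature.Probability.LatticeModels.sum_setPartitions_prod_hcUrsell]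
  push_cast
  rfl

omit [Fintype ι] [MeasurableSpace X] in
/-- The block decomposition of the Mayer identity at a label `i ∈ W`:
`𝟙[x ∈ hardCoreSet W] = ∑_{B ∋ i} u_B(x) 𝟙[x ∈ hardCoreSet (W \ B)]`. [folklore] -/
theorem efR_eq_sum_uR_mul_efR (x : ι → X) {W : Finset ι} {i : ι} (hi : i ∈ W) :
    efR O x W = ∑ B ∈ W.powerset.filter (fun B => i ∈ B), uR O x B * efR O x (W \ B) := by
  unfold uR efR
  rw [← Literature.Probability.LatticeModels.sum_hcUrsell_mul_edgeFreeInd hi]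
  push_cast
  rfl

omit [Fintype ι] [MeasurableSpace X] in
/-- `|u_B(x)| ≤ hcUrsellBound B` uniformly in the configuration. [folklore] -/
theorem abs_uR_le (x : ι → X) (B : Finset ι) : |uR O x B| ≤ Literature.Probability.LatticeModels.hcUrsellBound B := by
  unfold uR
  exact_mod_cast Literature.Probability.LatticeModels.abs_hcUrsell_le_hcUrsellBound (H := overlapRel O x) B

omit [Fintype ι] [MeasurableSpace X] in
/-- `|efR| ≤ 1`. [folklore] -/
theorem abs_efR_le_one (x : ι → X) (W : Finset ι) : |efR O x W| ≤ 1 := by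
  rw [efR_eq_indicator]
  by_cases h : x ∈ hardCoreSet O W <;> simp [h]

omit [Fintype ι] [MeasurableSpace X] in
/-- `0 ≤ efR`. [folklore] -/
theorem efR_nonneg (x : ι → X) (W : Finset ι) : 0 ≤ efR O x W := by
  rw [efR_eq_indicator]
  by_cases h : x ∈ hardCoreSet O W <;> simp [h]

/-! ### Locality: dependence on the coordinates of the block only -/

omit [Fintype ι] [MeasurableSpace X] in
/-- `u_B` depends only on the coordinates in `B`. [folklore] -/
theorem dependsOn_uR (B : Finset ι) : DependsOn (fun x : ι → X => uR O x B) (B : Set ι) := by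
  intro x y hxy
  simp only [uR]
  rw [Literature.Probability.LatticeModels.hcUrsell_congr (H := overlapRel O x) (H' := overlapRel O y) (fun u hu w hw => ?_)]
  change (u ≠ w ∧ O (x u) (x w)) ↔ (u ≠ w ∧ O (y u) (y w))
  rw [hxy u hu, hxy w hw]

omit [Fintype ι] [MeasurableSpace X] in
/-- `efR W` depends only on the coordinates in `W`. [folklore] -/
theorem dependsOn_efR (W : Finset ι) : DependsOn (fun x : ι → X => efR O x W) (W : Set ι) := by
  intro x y hxy
  have hiff : x ∈ hardCoreSet O W ↔ y ∈ hardCoreSet O W :=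
    forall₂_congr fun i hi => forall₂_congr fun j hj => by rw [hxy i hi, hxy j hj]
  simp only [efR_eq_indicator]
  by_cases h : x ∈ hardCoreSet O W
  · rw [Set.indicator_of_mem h, Set.indicator_of_mem (hiff.1 h)]; rfl
  · rw [Set.indicator_of_notMem h, Set.indicator_of_notMem (fun h' => h (hiff.2 h'))]

/-! ### Measurability -/

variable (hO : MeasurableSet {p : X × X | O p.1 p.2})
include hO

omit [Fintype ι] [DecidableEq ι] in
/-- The overlap event of two labels is measurable. [folklore] -/
theorem measurableSet_overlap (i j : ι) : MeasurableSet {x : ι → X | O (x i) (x j)} := by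
  change MeasurableSet ((fun a : ι → X => (a i, a j)) ⁻¹' {p : X × X | O p.1 p.2})
  exact hO.preimage ((measurable_pi_apply i).prodMk (measurable_pi_apply j))

omit [Fintype ι] [DecidableEq ι] in
/-- The hard-core sets are measurable. [folklore] -/
theorem measurableSet_hardCoreSet (W : Finset ι) : MeasurableSet (hardCoreSet O W : Set (ι → X)) := by
  have : hardCoreSet O W = ⋂ i ∈ W, ⋂ j ∈ W, {x : ι → X | i ≠ j → ¬ O (x i) (x j)} := by
    ext x; simp [hardCoreSet]
  rw [this]
  refine MeasurableSet.biInter (W.countable_toSet) fun i _ =>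
    MeasurableSet.biInter (W.countable_toSet) fun j _ => ?_
  by_cases hij : i = j
  · simp [hij]
  · simp only [ne_eq, hij, not_false_eq_true, forall_const]
    exact (measurableSet_overlap hO i j).compl

omit [Fintype ι] in
/-- `efR W` is measurable. [folklore] -/
theorem measurable_efR (W : Finset ι) : Measurable fun x : ι → X => efR O x W := by
  have : (fun x : ι → X => efR O x W) = (hardCoreSet O W).indicator 1 :=
    funext fun x => efR_eq_indicator x W
  rw [this]
  exact measurable_one.indicator (measurableSet_hardCoreSet hO W)

omit [Fintype ι] in
/-- `u_B` is measurable (induction on the Möbius recursion). [folklore] -/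
theorem measurable_uR (B : Finset ι) : Measurable fun x : ι → X => uR O x B := by
  induction B using Finset.strongInduction with
  | H B ih =>
    have : (fun x : ι → X => uR O x B) = fun x =>
        efR O x B - ∑ π ∈ (Literature.Probability.LatticeModels.setPartitions B).erase {B}, ∏ P ∈ π, uR O x P :=
      funext fun x => uR_eq x B
    rw [this]
    refine (measurable_efR hO B).sub (Finset.measurable_sum _ fun π hπ => ?_)
    refine Finset.measurable_prod _ fun P hP => ?_
    obtain ⟨hne, hπ'⟩ := mem_erase.1 hπ
    exact ih P ((Literature.Probability.LatticeModels.mem_setPartitions.1 hπ').ssubset_of_ne_singleton hne hP)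

omit hO

/-! ### Factorisation over disjoint blocks and the decorated expansions -/

variable (ν : Measure X) [IsProbabilityMeasure ν]

omit [DecidableEq ι] in
/-- Bounded measurable functions are integrable for the product probability measure. [folklore] -/
theorem integrable_pi_of_bounded {F : (ι → X) → ℝ} (hF : Measurable F) {C : ℝ} (hC : ∀ x, |F x| ≤ C) :
    Integrable F (Measure.pi fun _ : ι => ν) :=
  Integrable.mono' (integrable_const C) hF.aestronglyMeasurable
    (ae_of_all _ fun x => (Real.norm_eq_abs _).le.trans (hC x))

/-- **Factorisation**: the integral of a product of bounded measurable functions depending on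
disjoint sets of labels is the product of the integrals. [folklore] -/
theorem integral_mul_eq_of_dependsOn {S T : Finset ι} (hST : Disjoint S T) {F G : (ι → X) → ℝ}
    (hFm : Measurable F) (hGm : Measurable G) (hF : DependsOn F (S : Set ι))
    (hG : DependsOn G (T : Set ι)) :
    ∫ x, F x * G x ∂Measure.pi (fun _ : ι => ν) =
      (∫ x, F x ∂Measure.pi (fun _ : ι => ν)) * ∫ x, G x ∂Measure.pi (fun _ : ι => ν) := by
  rw [← Measure.infinitePi_eq_pi]
  exact Literature.Probability.LatticeModels.integral_mul_eq_of_dependsOn_disjoint (fun _ : ι => ν) hST hFm hGm hF hG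

/-- The **hard-core probability** `Ξ(W) = ℙ(no two points labelled by W overlap)` of the labels
`W` under the product measure (the configurational canonical partition function of `#W` hard-core
particles, normalised by the ideal-gas one). [cite: PulvirentiTsagkarogiannis2012, §3] -/
noncomputable def hcProb (O : X → X → Prop) (ν : Measure X) (W : Finset ι) : ℝ :=
  (Measure.pi fun _ : ι => ν).real (hardCoreSet O W)

omit [IsProbabilityMeasure ν] in
/-- `Ξ(W) = ∫ 𝟙[hardCoreSet W]`. [folklore] -/
theorem integral_efR (hO : MeasurableSet {p : X × X | O p.1 p.2}) (W : Finset ι) :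
    ∫ x, efR O x W ∂Measure.pi (fun _ : ι => ν) = hcProb O ν W := by
  simp_rw [efR_eq_indicator]
  exact integral_indicator_one (measurableSet_hardCoreSet hO W)

/-- The **decorated activity** `w^g(B) = ∫ g(x_i) u_B(x) dℙ` of a block `B` with the one-body
observable `g` at the label `i`. [cite: PulvirentiTsagkarogiannis2012, §3] -/
noncomputable def decAct (O : X → X → Prop) (ν : Measure X) (g : X → ℝ) (i : ι) (B : Finset ι) : ℝ :=
  ∫ x, g (x i) * uR O x B ∂Measure.pi (fun _ : ι => ν)

/-- **The decorated expansion** (the canonical Mayer expansion with one marked particle). For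
`i ∈ W` and a bounded measurable one-body observable `g`,
`∫ g(x_i) 𝟙[hardCoreSet W] dℙ = ∑_{B ∋ i, B ⊆ W} w^g(B) · Ξ(W \ B)`:
expand the hard-core indicator by the Mayer identity, single out the block of `i`, and factorise
(the block and the rest involve disjoint labels). With `g = 1` this is the polymer representation
of the canonical partition function on vertex sets `V ⊆ {1,…,N}`.
[cite: PulvirentiTsagkarogiannis2012, §3] -/
theorem integral_mul_efR_eq_sum (hO : MeasurableSet {p : X × X | O p.1 p.2}) {W : Finset ι} {i : ι}
    (hi : i ∈ W) {g : X → ℝ} (hg : Measurable g) {C : ℝ} (hgC : ∀ y, |g y| ≤ C) :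
    ∫ x, g (x i) * efR O x W ∂Measure.pi (fun _ : ι => ν) =
      ∑ B ∈ W.powerset.filter (fun B => i ∈ B), decAct O ν g i B * hcProb O ν (W \ B) := by
  have hpt : ∀ x : ι → X, g (x i) * efR O x W =
      ∑ B ∈ W.powerset.filter (fun B => i ∈ B), (g (x i) * uR O x B) * efR O x (W \ B) := by
    intro x
    rw [efR_eq_sum_uR_mul_efR x hi, mul_sum]
    simp_rw [mul_assoc]
  simp_rw [hpt]
  rw [integral_finsetSum]
  · refine sum_congr rfl fun B hB => ?_
    obtain ⟨hBW, hiB⟩ := mem_filter.1 hB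
    have hgi : Measurable fun x : ι → X => g (x i) := hg.comp (measurable_pi_apply i)
    have hdep : DependsOn (fun x : ι → X => g (x i) * uR O x B) (B : Set ι) := by
      intro x y hxy
      have h2 : uR O x B = uR O y B := dependsOn_uR B hxy
      simp only
      rw [hxy i hiB, h2]
    have hfac := integral_mul_eq_of_dependsOn ν (disjoint_sdiff (s := B) (t := W))
      (F := fun x => g (x i) * uR O x B) (G := fun x => efR O x (W \ B))
      (hgi.mul (measurable_uR hO B)) (measurable_efR hO _) hdep (dependsOn_efR _)
    rw [hfac, decAct, integral_efR ν hO]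
  · intro B _
    have hgi : Measurable fun x : ι → X => g (x i) := hg.comp (measurable_pi_apply i)
    refine integrable_pi_of_bounded ν ((hgi.mul (measurable_uR hO B)).mul (measurable_efR hO _))
      (C := |C| * Literature.Probability.LatticeModels.hcUrsellBound B * 1) fun x => ?_
    rw [abs_mul, abs_mul]
    refine mul_le_mul (mul_le_mul ((hgC _).trans (le_abs_self C)) (abs_uR_le x B)
      (abs_nonneg _) (abs_nonneg _)) (abs_efR_le_one x _) (abs_nonneg _) (by positivity)

/-! ### Integrating out one coordinate; products over the blocks of a set partition -/

open scoped ENNReal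

/-- **Integrating out one coordinate** (Tonelli form): for measurable `F ≥ 0`,
`∫⁻ F dℙ = ∫⁻ (∫⁻ F (update x u y) dν(y)) dℙ(x)`. [folklore] -/
theorem lintegral_pi_eq_lintegral_update (u : ι) {F : (ι → X) → ℝ≥0∞} (hF : Measurable F) :
    ∫⁻ x, F x ∂Measure.pi (fun _ : ι => ν) =
      ∫⁻ x, ∫⁻ y, F (Function.update x u y) ∂ν ∂Measure.pi (fun _ : ι => ν) := by
  have hmeas : Measurable fun q : (ι → X) × X => Function.update q.1 u q.2 := measurable_update'
  have hmap : ((Measure.pi fun _ : ι => ν).prod ν).map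
      (fun q : (ι → X) × X => Function.update q.1 u q.2) = Measure.pi fun _ : ι => ν := by
    have := Literature.Probability.LatticeModels.map_update_infinitePi_prod (fun _ : ι => ν) u
    rwa [Measure.infinitePi_eq_pi] at this
  calc ∫⁻ x, F x ∂Measure.pi (fun _ => ν)
      = ∫⁻ x, F x ∂(((Measure.pi fun _ : ι => ν).prod ν).map
          fun q : (ι → X) × X => Function.update q.1 u q.2) := by rw [hmap]
    _ = ∫⁻ q, F (Function.update q.1 u q.2) ∂((Measure.pi fun _ : ι => ν).prod ν) :=
        lintegral_map hF hmeas
    _ = _ := lintegral_prod _ (hF.comp hmeas).aemeasurable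

omit [Fintype ι] in
/-- A function of the configuration depending only on the labels in `S` factors measurably
through the restriction to `S`. [folklore] -/
theorem exists_measurable_comp_restrict' {β : Type*} [MeasurableSpace β] (S : Finset ι)
    (x₀ : ι → X) {F : (ι → X) → β} (hF : Measurable F) (hdep : DependsOn F (S : Set ι)) :
    ∃ F' : (S → X) → β, Measurable F' ∧ F = F' ∘ fun x (i : S) => x i := by
  refine ⟨fun z => F (fun i => if h : i ∈ S then z ⟨i, h⟩ else x₀ i), ?_, ?_⟩
  · refine hF.comp (measurable_pi_lambda _ fun i => ?_)
    by_cases h : i ∈ S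
    · simp only [h, dif_pos]; exact measurable_pi_apply _
    · simp only [h, dif_neg, not_false_eq_true]; exact measurable_const
  · ext x
    refine hdep fun i hi => ?_
    simp [Finset.mem_coe.1 hi]

/-- Functions depending on disjoint sets of labels are independent under the product measure.
[folklore] -/
theorem indepFun_of_dependsOn {β γ : Type*} [MeasurableSpace β] [MeasurableSpace γ]
    {S T : Finset ι} (hST : Disjoint S T) {F : (ι → X) → β} {G : (ι → X) → γ}
    (hFm : Measurable F) (hGm : Measurable G) (hF : DependsOn F (S : Set ι))
    (hG : DependsOn G (T : Set ι)) : IndepFun F G (Measure.pi fun _ : ι => ν) := by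
  obtain ⟨y₀⟩ : Nonempty X := Filter.nonempty_of_neBot (ae ν)
  let x₀ : ι → X := fun _ => y₀
  obtain ⟨F', hF'm, hFF'⟩ := exists_measurable_comp_restrict' S x₀ hFm hF
  obtain ⟨G', hG'm, hGG'⟩ := exists_measurable_comp_restrict' T x₀ hGm hG
  have hind : IndepFun (fun x (i : S) => x (i : ι)) (fun x (i : T) => x (i : ι))
      (Measure.pi fun _ : ι => ν) :=
    (iIndepFun_pi (μ := fun _ : ι => ν) (X := fun _ (y : X) => y) fun _ =>
      aemeasurable_id).indepFun_finset S T hST fun i => measurable_pi_apply i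
  rw [hFF', hGG']
  exact hind.comp hF'm hG'm

/-- **Products over the blocks factorise**: for a pairwise disjoint family `ρ` of label sets and
measurable `F_Q ≥ 0` depending only on the labels in `Q`,
`∫⁻ ∏_{Q ∈ ρ} F_Q dℙ = ∏_{Q ∈ ρ} ∫⁻ F_Q dℙ`. [folklore] -/
theorem lintegral_prod_eq_prod_lintegral {ρ : Finset (Finset ι)}
    (hdisj : (ρ : Set (Finset ι)).PairwiseDisjoint id) {F : Finset ι → (ι → X) → ℝ≥0∞}
    (hFm : ∀ Q ∈ ρ, Measurable (F Q)) (hFd : ∀ Q ∈ ρ, DependsOn (F Q) (Q : Set ι)) :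
    ∫⁻ x, ∏ Q ∈ ρ, F Q x ∂Measure.pi (fun _ : ι => ν) =
      ∏ Q ∈ ρ, ∫⁻ x, F Q x ∂Measure.pi (fun _ : ι => ν) := by
  induction ρ using Finset.induction_on with
  | empty => simp
  | @insert Q₀ ρ hQ₀ ih =>
    have hdisj' : (ρ : Set (Finset ι)).PairwiseDisjoint id :=
      hdisj.subset (Finset.coe_subset.2 (Finset.subset_insert _ _))
    simp_rw [Finset.prod_insert hQ₀]
    rw [← ih hdisj' (fun Q hQ => hFm Q (Finset.mem_insert_of_mem hQ))
        (fun Q hQ => hFd Q (Finset.mem_insert_of_mem hQ))]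
    have hm0 : Measurable (F Q₀) := hFm Q₀ (Finset.mem_insert_self _ _)
    have hm1 : Measurable fun x => ∏ Q ∈ ρ, F Q x :=
      Finset.measurable_prod _ fun Q hQ => hFm Q (Finset.mem_insert_of_mem hQ)
    refine lintegral_mul_eq_lintegral_mul_lintegral_of_indepFun hm0 hm1 ?_
    -- independence: `Q₀` versus the union of the other blocks
    have hST : Disjoint Q₀ (ρ.biUnion id) := by
      rw [Finset.disjoint_biUnion_right]
      intro Q hQ
      exact hdisj (Finset.mem_coe.2 (Finset.mem_insert_self _ _))
        (Finset.mem_coe.2 (Finset.mem_insert_of_mem hQ)) (fun h => hQ₀ (h ▸ hQ))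
    refine indepFun_of_dependsOn ν hST hm0 hm1 (hFd Q₀ (Finset.mem_insert_self _ _)) ?_
    intro x y hxy
    refine Finset.prod_congr rfl fun Q hQ => hFd Q (Finset.mem_insert_of_mem hQ) fun i hi => ?_
    exact hxy i (Finset.mem_coe.2 (Finset.mem_biUnion.2 ⟨Q, hQ, hi⟩))

/-! ### The tree bound on the Ursell weights -/

/-- The overlap indicator `𝟙[O a b] ∈ ℝ`. [folklore] -/
noncomputable def olap (O : X → X → Prop) (a b : X) : ℝ := by
  classical exact if O a b then 1 else 0

omit [MeasurableSpace X] in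
/-- `0 ≤ 𝟙[O a b]`. [folklore] -/
theorem olap_nonneg (a b : X) : 0 ≤ olap O a b := by
  unfold olap; split_ifs <;> norm_num

omit [MeasurableSpace X] in
/-- `𝟙[O a b] ≤ 1`. [folklore] -/
theorem olap_le_one (a b : X) : olap O a b ≤ 1 := by
  unfold olap; split_ifs <;> norm_num

omit [Fintype ι] [DecidableEq ι] [MeasurableSpace X] in
/-- `x ↦ 𝟙[O (x u) (x u')]` is the indicator of the overlap event. [folklore] -/
theorem olap_apply_eq_indicator (u u' : ι) (x : ι → X) :
    olap O (x u) (x u') = ({x : ι → X | O (x u) (x u')}).indicator 1 x := by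
  unfold olap
  split_ifs with h
  · rw [Set.indicator_of_mem (by exact h)]; rfl
  · rw [Set.indicator_of_notMem (by exact h)]

omit [Fintype ι] [DecidableEq ι] in
/-- `x ↦ 𝟙[O (x u) (x u')]` is measurable. [folklore] -/
theorem measurable_olap_apply (hO : MeasurableSet {p : X × X | O p.1 p.2}) (u u' : ι) :
    Measurable fun x : ι → X => olap O (x u) (x u') := by
  have : (fun x : ι → X => olap O (x u) (x u')) = ({x : ι → X | O (x u) (x u')}).indicator 1 :=
    funext fun x => olap_apply_eq_indicator u u' x
  rw [this]
  exact measurable_one.indicator (measurableSet_overlap hO u u')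

omit [Fintype ι] [DecidableEq ι] [MeasurableSpace X] in
/-- `|𝟙[Q ∼ u]| ≤ ∑_{u' ∈ Q} 𝟙[O (x u) (x u')]`: the adjacency indicator of a block is at most the
number of its points overlapping `x u`. [folklore] -/
theorem abs_adjInd_le_sum_olap (x : ι → X) (u : ι) (Q : Finset ι) :
    |(Literature.Probability.LatticeModels.adjInd (overlapRel O x) u Q : ℝ)| ≤ ∑ u' ∈ Q, olap O (x u) (x u') := by
  unfold Literature.Probability.LatticeModels.adjInd
  split_ifs with h
  · obtain ⟨u', hu', hH⟩ := h
    rw [Int.cast_one, abs_one]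
    refine le_trans ?_ (Finset.single_le_sum (f := fun v => olap O (x u) (x v))
      (fun v _ => olap_nonneg _ _) hu')
    simp only [olap, if_pos hH.2, le_refl]
  · rw [Int.cast_zero, abs_zero]
    exact Finset.sum_nonneg fun v _ => olap_nonneg _ _

omit [Fintype ι] [MeasurableSpace X] in
/-- **The rooted recursion as a pointwise bound.** For `O` symmetric and `u ∈ B`,
`|u_B(x)| ≤ ∑_{ρ ∈ setPartitions (B \ u)} ∏_{Q ∈ ρ} (∑_{u' ∈ Q} 𝟙[O (x u) (x u')]) |u_Q(x)|`.
[cite: FriedliVelenik2017, §5.4, proof of Thm. 5.4, (5.13)–(5.15)] -/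
theorem abs_uR_le_sum_setPartitions (hOs : ∀ a b, O a b → O b a) (x : ι → X) {B : Finset ι}
    {u : ι} (hu : u ∈ B) :
    |uR O x B| ≤ ∑ ρ ∈ Literature.Probability.LatticeModels.setPartitions (B.erase u),
      ∏ Q ∈ ρ, (∑ u' ∈ Q, olap O (x u) (x u')) * |uR O x Q| := by
  unfold uR
  rw [Literature.Probability.LatticeModels.hcUrsell_eq_hcRootedUrsell (overlapRel_symm hOs x) hu, Literature.Probability.LatticeModels.hcRootedUrsell]
  push_cast
  refine (Finset.abs_sum_le_sum_abs _ _).trans (Finset.sum_le_sum fun ρ _ => ?_)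
  rw [abs_mul, abs_pow, abs_neg, abs_one, one_pow, one_mul, Finset.abs_prod]
  refine Finset.prod_le_prod (fun Q _ => abs_nonneg _) fun Q _ => ?_
  rw [abs_mul]
  exact mul_le_mul_of_nonneg_right (abs_adjInd_le_sum_olap x u Q) (abs_nonneg _)

omit [MeasurableSpace X] in
/-- `𝟙[O y ·]` is the indicator of the section `{b | O y b}`. [folklore] -/
theorem olap_eq_indicator_right (y : X) : olap O y = ({b : X | O y b}).indicator 1 := by
  funext b; unfold olap; split_ifs with h
  · rw [Set.indicator_of_mem (by exact h)]; rfl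
  · rw [Set.indicator_of_notMem (by exact h)]

/-- Sections of the overlap set are measurable. [folklore] -/
theorem measurableSet_olap_right (hO : MeasurableSet {p : X × X | O p.1 p.2}) (y : X) :
    MeasurableSet {b : X | O y b} :=
  hO.preimage (measurable_const.prodMk measurable_id)

/-- `𝟙[O y ·]` is measurable. [folklore] -/
theorem measurable_olap_right (hO : MeasurableSet {p : X × X | O p.1 p.2}) (y : X) :
    Measurable (olap O y) := by
  rw [olap_eq_indicator_right]
  exact measurable_one.indicator (measurableSet_olap_right hO y)

/-- `∫⁻ 𝟙[O y ·] dν = ν {b | O y b}`. [folklore] -/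
theorem lintegral_ofReal_olap (hO : MeasurableSet {p : X × X | O p.1 p.2}) (ν : Measure X) (y : X) :
    ∫⁻ b, ENNReal.ofReal (olap O y b) ∂ν = ν {b | O y b} := by
  have h1 : (fun b => ENNReal.ofReal (olap O y b)) = ({b : X | O y b}).indicator 1 := by
    funext b; rw [olap_eq_indicator_right]
    by_cases h : b ∈ {b : X | O y b}
    · rw [Set.indicator_of_mem h, Set.indicator_of_mem h]; simp
    · rw [Set.indicator_of_notMem h, Set.indicator_of_notMem h]; simp
  rw [h1, lintegral_indicator_one (measurableSet_olap_right hO y)]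

/-- The `ℝ≥0∞`-valued absolute Ursell weight `A_B(x) = |u_B(x)|`. [folklore] -/
noncomputable def aU (O : X → X → Prop) (x : ι → X) (B : Finset ι) : ℝ≥0∞ := ENNReal.ofReal |uR O x B|

omit [Fintype ι] in
/-- `A_B` is measurable. [folklore] -/
theorem measurable_aU (hO : MeasurableSet {p : X × X | O p.1 p.2}) (B : Finset ι) :
    Measurable fun x : ι → X => aU O x B :=
  ENNReal.measurable_ofReal.comp ((measurable_uR hO B).abs)

/-- **The tree bound on the Ursell weights** (the tree-graph inequality, integrated). Let `O` be
symmetric and measurable with `ν{y : O z y} ≤ p` for all `z`. Then for every block `B`, every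
`u ∈ B` and every measurable `φ ≥ 0` on `X`,
`∫⁻ φ(x_u) |u_B(x)| dℙ ≤ (∫⁻ φ dν) · t(#B) p^{#B - 1}`, `t` the tree numbers. Induction on `#B`
with the rooted recursion at `u`: integrate out `x_u` first; the blocks of `B \ u` are independent;
each block `Q` contributes `∑_{u' ∈ Q} ∫⁻ 𝟙[O (x_u) (x_{u'})] |u_Q| ≤ #Q · t(#Q) p^{#Q}` by the
induction hypothesis with `φ = 𝟙[O y ·]`; and `∑_ρ ∏_Q #Q t(#Q) = t(#B)`.
[cite: PulvirentiTsagkarogiannis2012, §4] -/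
theorem lintegral_mul_aU_le (hO : MeasurableSet {p : X × X | O p.1 p.2})
    (hOs : ∀ a b, O a b → O b a) {p : ℝ} (hp0 : 0 ≤ p)
    (hp : ∀ z, ν {y | O z y} ≤ ENNReal.ofReal p) (B : Finset ι) {u : ι} (hu : u ∈ B)
    {φ : X → ℝ≥0∞} (hφ : Measurable φ) :
    ∫⁻ x, φ (x u) * aU O x B ∂Measure.pi (fun _ : ι => ν) ≤
      (∫⁻ y, φ y ∂ν) * ENNReal.ofReal (Literature.Probability.LatticeModels.treeNumber B.card * p ^ (B.card - 1)) := by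
  induction B using Finset.strongInduction generalizing u φ with
  | H B ih =>
    set P := Measure.pi (fun _ : ι => ν) with hP
    -- the block weights after deleting `u`
    set G : Finset ι → X → (ι → X) → ℝ≥0∞ := fun Q y x =>
      ENNReal.ofReal ((∑ u' ∈ Q, olap O y (x u')) * |uR O x Q|) with hG
    set c : Finset ι → ℝ≥0∞ := fun Q =>
      ENNReal.ofReal ((Q.card : ℝ) * Literature.Probability.LatticeModels.treeNumber Q.card * p ^ Q.card) with hc
    have holapm : ∀ u' : ι, Measurable fun q : (ι → X) × X => ENNReal.ofReal (olap O q.2 (q.1 u')) := by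
      intro u'
      refine ENNReal.measurable_ofReal.comp ?_
      have h1 : (fun q : (ι → X) × X => olap O q.2 (q.1 u')) =
          ({q : (ι → X) × X | O q.2 (q.1 u')}).indicator 1 := by
        funext q; unfold olap; split_ifs with h
        · rw [Set.indicator_of_mem (by exact h)]; rfl
        · rw [Set.indicator_of_notMem (by exact h)]
      rw [h1]
      exact measurable_one.indicator
        (hO.preimage (measurable_snd.prodMk ((measurable_pi_apply u').comp measurable_fst)))
    have holapm' : ∀ u' : ι, Measurable fun q : (ι → X) × X => olap O q.2 (q.1 u') := by
      intro u'
      have h1 : (fun q : (ι → X) × X => olap O q.2 (q.1 u')) =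
          ({q : (ι → X) × X | O q.2 (q.1 u')}).indicator 1 := by
        funext q; unfold olap; split_ifs with h
        · rw [Set.indicator_of_mem (by exact h)]; rfl
        · rw [Set.indicator_of_notMem (by exact h)]
      rw [h1]
      exact measurable_one.indicator
        (hO.preimage (measurable_snd.prodMk ((measurable_pi_apply u').comp measurable_fst)))
    have hGm2 : ∀ Q, Measurable fun q : (ι → X) × X => G Q q.2 q.1 := by
      intro Q
      exact ENNReal.measurable_ofReal.comp ((Finset.measurable_sum _ fun u' _ => holapm' u').mul
        ((measurable_uR hO Q).comp measurable_fst).abs)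
    have hGm : ∀ Q y, Measurable (G Q y) := fun Q y =>
      (hGm2 Q).comp (measurable_id.prodMk measurable_const)
    have hGd : ∀ Q y, DependsOn (G Q y) (Q : Set ι) := by
      intro Q y x x' hxx'
      simp only [hG]
      congr 2
      · exact Finset.sum_congr rfl fun u' hu' => by rw [hxx' u' hu']
      · have h2 : uR O x Q = uR O x' Q := dependsOn_uR Q hxx'
        rw [h2]
    have hGm3 : ∀ Q, Measurable fun x : ι → X => G Q (x u) x := fun Q =>
      (hGm2 Q).comp (measurable_id.prodMk (measurable_pi_apply u))
    have hmeas_sum : ∀ ρ ∈ Literature.Probability.LatticeModels.setPartitions (B.erase u),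
        Measurable fun x : ι → X => φ (x u) * ∏ Q ∈ ρ, G Q (x u) x := fun ρ _ =>
      (hφ.comp (measurable_pi_apply u)).mul (Finset.measurable_prod ρ fun Q _ => hGm3 Q)
    -- Step 1: pointwise domination by the rooted recursion
    have hpt : ∀ x : ι → X, φ (x u) * aU O x B ≤
        ∑ ρ ∈ Literature.Probability.LatticeModels.setPartitions (B.erase u), φ (x u) * ∏ Q ∈ ρ, G Q (x u) x := by
      intro x
      rw [← Finset.mul_sum]
      gcongr
      simp only [aU, hG]
      calc ENNReal.ofReal |uR O x B|
          ≤ ENNReal.ofReal (∑ ρ ∈ Literature.Probability.LatticeModels.setPartitions (B.erase u),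
              ∏ Q ∈ ρ, (∑ u' ∈ Q, olap O (x u) (x u')) * |uR O x Q|) :=
            ENNReal.ofReal_le_ofReal (abs_uR_le_sum_setPartitions hOs x hu)
        _ = _ := by
            rw [ENNReal.ofReal_sum_of_nonneg fun ρ _ => Finset.prod_nonneg fun Q _ =>
              mul_nonneg (Finset.sum_nonneg fun _ _ => olap_nonneg _ _) (abs_nonneg _)]
            refine Finset.sum_congr rfl fun ρ _ => ?_
            exact ENNReal.ofReal_prod_of_nonneg fun Q _ =>
              mul_nonneg (Finset.sum_nonneg fun _ _ => olap_nonneg _ _) (abs_nonneg _)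
    -- Step 2: integrate out `x u`, factorise over the blocks, use the induction hypothesis
    have hρ : ∀ ρ ∈ Literature.Probability.LatticeModels.setPartitions (B.erase u),
        ∫⁻ x, φ (x u) * ∏ Q ∈ ρ, G Q (x u) x ∂P ≤
          (∫⁻ y, φ y ∂ν) * ∏ Q ∈ ρ, c Q := by
      intro ρ hρ
      have hρ' := Literature.Probability.LatticeModels.mem_setPartitions.1 hρ
      rw [lintegral_pi_eq_lintegral_update ν u (hmeas_sum ρ hρ)]
      -- the update replaces `x u` by `y` and leaves the blocks untouched
      have hupd : ∀ (x : ι → X) (y : X),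
          φ (Function.update x u y u) * ∏ Q ∈ ρ, G Q (Function.update x u y u) (Function.update x u y) =
            φ y * ∏ Q ∈ ρ, G Q y x := by
        intro x y
        rw [Function.update_self]
        congr 1
        refine Finset.prod_congr rfl fun Q hQ => hGd Q y fun i hi => ?_
        have hiu : i ≠ u := fun h => (Finset.mem_erase.1 (hρ'.subset hQ (h ▸ hi))).1 rfl
        exact Function.update_of_ne hiu _ _
      simp_rw [hupd]
      -- swap the integrals (Tonelli)
      have hsw : ∫⁻ x, ∫⁻ y, φ y * ∏ Q ∈ ρ, G Q y x ∂ν ∂P = ∫⁻ y, ∫⁻ x, φ y * ∏ Q ∈ ρ, G Q y x ∂P ∂ν := by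
        refine lintegral_lintegral_swap ((hφ.comp measurable_snd).mul
          (Finset.measurable_prod _ fun Q _ => ?_)).aemeasurable
        exact hGm2 Q
      rw [hsw]
      -- inner integral: constant times a product of independent block integrals
      have hinner : ∀ y, ∫⁻ x, φ y * ∏ Q ∈ ρ, G Q y x ∂P ≤
          φ y * ∏ Q ∈ ρ, c Q := by
        intro y
        rw [lintegral_const_mul _ (Finset.measurable_prod _ fun Q _ => hGm Q y),
          lintegral_prod_eq_prod_lintegral ν hρ'.pairwiseDisjoint (fun Q _ => hGm Q y)
            (fun Q _ => hGd Q y)]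
        gcongr with Q hQ
        -- one block: `∑_{u'} ∫⁻ 𝟙[O y (x u')] |u_Q| ≤ #Q · p · t(#Q) p^{#Q-1}`
        have hQB : Q ⊂ B := lt_of_le_of_lt (hρ'.subset hQ) (Finset.erase_ssubset hu)
        have hQne : Q.Nonempty := hρ'.nonempty_of_mem hQ
        have hsplit : ∀ x, G Q y x = ∑ u' ∈ Q, ENNReal.ofReal (olap O y (x u')) * aU O x Q := by
          intro x
          simp only [hG, aU]
          rw [Finset.sum_mul, ENNReal.ofReal_sum_of_nonneg fun u' _ =>
            mul_nonneg (olap_nonneg _ _) (abs_nonneg _)]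
          exact Finset.sum_congr rfl fun u' _ => ENNReal.ofReal_mul (olap_nonneg _ _)
        simp_rw [hsplit]
        have hmeas_u' : ∀ u' : ι, Measurable fun x : ι → X => ENNReal.ofReal (olap O y (x u')) :=
          fun u' => (holapm u').comp (measurable_id.prodMk measurable_const)
        rw [lintegral_finsetSum Q (f := fun u' x => ENNReal.ofReal (olap O y (x u')) * aU O x Q)
          (fun u' _ => (hmeas_u' u').mul (measurable_aU hO Q))]
        have hterm : ∀ u' ∈ Q, ∫⁻ x, ENNReal.ofReal (olap O y (x u')) * aU O x Q ∂P ≤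
            ENNReal.ofReal p * ENNReal.ofReal (Literature.Probability.LatticeModels.treeNumber Q.card * p ^ (Q.card - 1)) := by
          intro u' hu'
          have hφ' : Measurable fun b : X => ENNReal.ofReal (olap O y b) :=
            ENNReal.measurable_ofReal.comp (measurable_olap_right hO y)
          refine (ih Q hQB hu' hφ').trans ?_
          gcongr
          -- `∫⁻ 𝟙[O y ·] dν = ν {O y ·} ≤ p`
          rw [lintegral_ofReal_olap hO ν y]
          exact hp y
        calc ∑ u' ∈ Q, ∫⁻ x, ENNReal.ofReal (olap O y (x u')) * aU O x Q ∂P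
            ≤ ∑ _u' ∈ Q, ENNReal.ofReal p * ENNReal.ofReal (Literature.Probability.LatticeModels.treeNumber Q.card * p ^ (Q.card - 1)) :=
              Finset.sum_le_sum hterm
          _ = c Q := by
              simp only [hc]
              have hk : Q.card = (Q.card - 1) + 1 :=
                (Nat.succ_pred_eq_of_pos (Finset.card_pos.2 hQne)).symm
              have hpow : p ^ Q.card = p ^ (Q.card - 1) * p := by
                rw [← pow_succ]; exact congrArg (p ^ ·) hk
              have hreal : (Q.card : ℝ) * (p * (Literature.Probability.LatticeModels.treeNumber Q.card * p ^ (Q.card - 1))) =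
                  Q.card * Literature.Probability.LatticeModels.treeNumber Q.card * p ^ Q.card := by
                rw [hpow]; ring
              rw [Finset.sum_const, nsmul_eq_mul, ← ENNReal.ofReal_mul hp0,
                ← ENNReal.ofReal_natCast, ← ENNReal.ofReal_mul (Nat.cast_nonneg _), hreal]
      calc ∫⁻ y, ∫⁻ x, φ y * ∏ Q ∈ ρ, G Q y x ∂P ∂ν
          ≤ ∫⁻ y, φ y * ∏ Q ∈ ρ, c Q ∂ν :=
            lintegral_mono hinner
        _ = (∫⁻ y, φ y ∂ν) * ∏ Q ∈ ρ, c Q :=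
            lintegral_mul_const _ hφ
    -- Step 3: sum over `ρ` and evaluate the tree recursion
    calc ∫⁻ x, φ (x u) * aU O x B ∂P
        ≤ ∫⁻ x, ∑ ρ ∈ Literature.Probability.LatticeModels.setPartitions (B.erase u), φ (x u) * ∏ Q ∈ ρ, G Q (x u) x ∂P :=
          lintegral_mono hpt
      _ = ∑ ρ ∈ Literature.Probability.LatticeModels.setPartitions (B.erase u), ∫⁻ x, φ (x u) * ∏ Q ∈ ρ, G Q (x u) x ∂P :=
          lintegral_finsetSum _ hmeas_sum
      _ ≤ ∑ ρ ∈ Literature.Probability.LatticeModels.setPartitions (B.erase u),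
            (∫⁻ y, φ y ∂ν) * ∏ Q ∈ ρ, c Q :=
          Finset.sum_le_sum hρ
      _ = (∫⁻ y, φ y ∂ν) * ENNReal.ofReal (Literature.Probability.LatticeModels.treeNumber B.card * p ^ (B.card - 1)) := by
          rw [← Finset.mul_sum]
          congr 1
          have hρsum : ∀ ρ ∈ Literature.Probability.LatticeModels.setPartitions (B.erase u),
              ∏ Q ∈ ρ, c Q =
                ENNReal.ofReal (∏ Q ∈ ρ, ((Q.card : ℝ) * Literature.Probability.LatticeModels.treeNumber Q.card * p ^ Q.card)) :=
            fun ρ _ => by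
              simp only [hc]
              exact (ENNReal.ofReal_prod_of_nonneg fun Q _ => by positivity).symm
          rw [Finset.sum_congr rfl hρsum, ← ENNReal.ofReal_sum_of_nonneg fun ρ _ =>
            Finset.prod_nonneg fun Q _ => by positivity]
          congr 1
          -- `∑_ρ ∏_Q #Q t(#Q) p^{#Q} = p^{#B - 1} t(#B)`
          have hcard : (B.erase u).card + 1 = B.card := Finset.card_erase_add_one hu
          have hcard' : (B.erase u).card = B.card - 1 := Finset.card_erase_of_mem hu
          have hnat : ∑ ρ ∈ Literature.Probability.LatticeModels.setPartitions (B.erase u), ∏ Q ∈ ρ, ((Q.card * Literature.Probability.LatticeModels.treeNumber Q.card : ℕ) : ℝ) =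
              (Literature.Probability.LatticeModels.treeNumber B.card : ℝ) := by
            rw [← hcard, ← Literature.Probability.LatticeModels.sum_setPartitions_prod_card_mul_treeNumber (B.erase u)]
            push_cast
            rfl
          calc ∑ ρ ∈ Literature.Probability.LatticeModels.setPartitions (B.erase u), ∏ Q ∈ ρ, ((Q.card : ℝ) * Literature.Probability.LatticeModels.treeNumber Q.card * p ^ Q.card)
              = ∑ ρ ∈ Literature.Probability.LatticeModels.setPartitions (B.erase u),
                  (∏ Q ∈ ρ, ((Q.card * Literature.Probability.LatticeModels.treeNumber Q.card : ℕ) : ℝ)) * p ^ (B.erase u).card := by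
                refine Finset.sum_congr rfl fun ρ hρ => ?_
                have h := Literature.Probability.LatticeModels.mem_setPartitions.1 hρ
                rw [Finset.prod_mul_distrib, Finset.prod_pow_eq_pow_sum, h.sum_card]
                push_cast
                rfl
            _ = (Literature.Probability.LatticeModels.treeNumber B.card : ℝ) * p ^ (B.card - 1) := by
                rw [← Finset.sum_mul, hnat, hcard']

/-! ### Real-valued bounds on the activities -/

/-- **Tree bound, integrated form**: `∫ |u_B| dℙ ≤ t(#B) p^{#B-1}` for a nonempty block.
[cite: PulvirentiTsagkarogiannis2012, §4] -/
theorem integral_abs_uR_le (hO : MeasurableSet {p : X × X | O p.1 p.2})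
    (hOs : ∀ a b, O a b → O b a) {p : ℝ} (hp0 : 0 ≤ p)
    (hp : ∀ z, ν {y | O z y} ≤ ENNReal.ofReal p) {B : Finset ι} (hB : B.Nonempty) :
    ∫ x, |uR O x B| ∂Measure.pi (fun _ : ι => ν) ≤ Literature.Probability.LatticeModels.treeNumber B.card * p ^ (B.card - 1) := by
  obtain ⟨u, hu⟩ := hB
  have h := lintegral_mul_aU_le ν hO hOs hp0 hp B hu (φ := fun _ => 1) measurable_const
  simp only [lintegral_const, measure_univ, mul_one, one_mul] at h
  rw [integral_eq_lintegral_of_nonneg_ae (ae_of_all _ fun x => abs_nonneg _)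
    ((measurable_uR hO B).abs.aestronglyMeasurable)]
  exact ENNReal.toReal_le_of_le_ofReal (by positivity) h

/-- `|w^g(B)| ≤ C t(#B) p^{#B-1}` for `|g| ≤ C`. [folklore] -/
theorem abs_decAct_le (hO : MeasurableSet {p : X × X | O p.1 p.2})
    (hOs : ∀ a b, O a b → O b a) {p : ℝ} (hp0 : 0 ≤ p)
    (hp : ∀ z, ν {y | O z y} ≤ ENNReal.ofReal p) {g : X → ℝ} (hg : Measurable g) {C : ℝ}
    (hgC : ∀ y, |g y| ≤ C) (i : ι) {B : Finset ι} (hB : B.Nonempty) :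
    |decAct O ν g i B| ≤ C * (Literature.Probability.LatticeModels.treeNumber B.card * p ^ (B.card - 1)) := by
  have y0 : X := (Filter.nonempty_of_neBot (ae ν)).some
  have hC0 : 0 ≤ C := (abs_nonneg _).trans (hgC y0)
  have hgi : Measurable fun x : ι → X => g (x i) := hg.comp (measurable_pi_apply i)
  have hint1 : Integrable (fun x : ι → X => |g (x i) * uR O x B|) (Measure.pi fun _ : ι => ν) :=
    (integrable_pi_of_bounded ν (F := fun x => g (x i) * uR O x B) (hgi.mul (measurable_uR hO B))
      (C := C * Literature.Probability.LatticeModels.hcUrsellBound B) fun x => by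
      rw [abs_mul]; exact mul_le_mul (hgC _) (abs_uR_le x B) (abs_nonneg _) hC0).abs
  have hint2 : Integrable (fun x : ι → X => C * |uR O x B|) (Measure.pi fun _ : ι => ν) :=
    (integrable_pi_of_bounded ν (measurable_uR hO B) (C := (Literature.Probability.LatticeModels.hcUrsellBound B : ℝ)) fun x =>
      abs_uR_le x B).abs.const_mul C
  calc |decAct O ν g i B| ≤ ∫ x, |g (x i) * uR O x B| ∂Measure.pi (fun _ : ι => ν) := by
        unfold decAct
        exact (Real.norm_eq_abs _).symm.trans_le ((norm_integral_le_integral_norm _).trans_eq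
          (integral_congr_ae (ae_of_all _ fun x => Real.norm_eq_abs _)))
    _ ≤ ∫ x, C * |uR O x B| ∂Measure.pi (fun _ : ι => ν) := by
        refine integral_mono hint1 hint2 fun x => ?_
        simp only [abs_mul]
        exact mul_le_mul_of_nonneg_right (hgC _) (abs_nonneg _)
    _ ≤ C * (Literature.Probability.LatticeModels.treeNumber B.card * p ^ (B.card - 1)) := by
        rw [integral_const_mul]
        exact mul_le_mul_of_nonneg_left (integral_abs_uR_le ν hO hOs hp0 hp hB) hC0

/-- `|∫ g(x_i) h(x_j) u_B| ≤ C C' t(#B) p^{#B-1}` for `|g| ≤ C`, `|h| ≤ C'`. [folklore] -/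
theorem abs_integral_mul_mul_uR_le (hO : MeasurableSet {p : X × X | O p.1 p.2})
    (hOs : ∀ a b, O a b → O b a) {p : ℝ} (hp0 : 0 ≤ p)
    (hp : ∀ z, ν {y | O z y} ≤ ENNReal.ofReal p) {g h : X → ℝ} (hg : Measurable g)
    (hh : Measurable h) {C C' : ℝ} (hgC : ∀ y, |g y| ≤ C) (hhC : ∀ y, |h y| ≤ C') (i j : ι)
    {B : Finset ι} (hB : B.Nonempty) :
    |∫ x, g (x i) * h (x j) * uR O x B ∂Measure.pi (fun _ : ι => ν)| ≤
      C * C' * (Literature.Probability.LatticeModels.treeNumber B.card * p ^ (B.card - 1)) := by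
  have y0 : X := (Filter.nonempty_of_neBot (ae ν)).some
  have hC0 : 0 ≤ C := (abs_nonneg _).trans (hgC y0)
  have hC0' : 0 ≤ C' := (abs_nonneg _).trans (hhC y0)
  have hgi : Measurable fun x : ι → X => g (x i) := hg.comp (measurable_pi_apply i)
  have hhj : Measurable fun x : ι → X => h (x j) := hh.comp (measurable_pi_apply j)
  have hint1 : Integrable (fun x : ι → X => |g (x i) * h (x j) * uR O x B|)
      (Measure.pi fun _ : ι => ν) :=
    (integrable_pi_of_bounded ν (F := fun x => g (x i) * h (x j) * uR O x B)
      ((hgi.mul hhj).mul (measurable_uR hO B)) (C := C * C' * Literature.Probability.LatticeModels.hcUrsellBound B) fun x => by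
      rw [abs_mul, abs_mul]
      exact mul_le_mul (mul_le_mul (hgC _) (hhC _) (abs_nonneg _) hC0) (abs_uR_le x B)
        (abs_nonneg _) (mul_nonneg hC0 hC0')).abs
  have hint2 : Integrable (fun x : ι → X => C * C' * |uR O x B|) (Measure.pi fun _ : ι => ν) :=
    (integrable_pi_of_bounded ν (measurable_uR hO B) (C := (Literature.Probability.LatticeModels.hcUrsellBound B : ℝ)) fun x =>
      abs_uR_le x B).abs.const_mul (C * C')
  calc |∫ x, g (x i) * h (x j) * uR O x B ∂Measure.pi (fun _ : ι => ν)|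
      ≤ ∫ x, |g (x i) * h (x j) * uR O x B| ∂Measure.pi (fun _ : ι => ν) :=
        (Real.norm_eq_abs _).symm.trans_le ((norm_integral_le_integral_norm _).trans_eq
          (integral_congr_ae (ae_of_all _ fun x => Real.norm_eq_abs _)))
    _ ≤ ∫ x, C * C' * |uR O x B| ∂Measure.pi (fun _ : ι => ν) := by
        refine integral_mono hint1 hint2 fun x => ?_
        simp only [abs_mul]
        exact mul_le_mul_of_nonneg_right (mul_le_mul (hgC _) (hhC _) (abs_nonneg _) hC0)
          (abs_nonneg _)
    _ ≤ C * C' * (Literature.Probability.LatticeModels.treeNumber B.card * p ^ (B.card - 1)) := by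
        rw [integral_const_mul]
        exact mul_le_mul_of_nonneg_left (integral_abs_uR_le ν hO hOs hp0 hp hB)
          (mul_nonneg hC0 hC0')

/-! ### The two-point decorated expansion -/

/-- **The decorated expansion with two marked particles.** For `i ≠ j` in `W`,
`∫ g(x_i) h(x_j) 𝟙[hardCoreSet W] = ∑_{B ∋ i, B ∌ j} w^g(B) ∫ h(x_j) 𝟙[hardCoreSet (W \ B)]`
`+ ∑_{B ∋ i, j} (∫ g(x_i) h(x_j) u_B) Ξ(W \ B)` (block of `i`; `j` is in it or not).
[cite: PulvirentiTsagkarogiannis2012, §3] -/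
theorem integral_mul_mul_efR_eq_sum (hO : MeasurableSet {p : X × X | O p.1 p.2}) {W : Finset ι}
    {i j : ι} (hi : i ∈ W) (hj : j ∈ W) {g h : X → ℝ} (hg : Measurable g) (hh : Measurable h)
    {C C' : ℝ} (hgC : ∀ y, |g y| ≤ C) (hhC : ∀ y, |h y| ≤ C') :
    ∫ x, g (x i) * h (x j) * efR O x W ∂Measure.pi (fun _ : ι => ν) =
      ∑ B ∈ (W.powerset.filter (fun B => i ∈ B)).filter (fun B => j ∉ B),
          decAct O ν g i B * ∫ x, h (x j) * efR O x (W \ B) ∂Measure.pi (fun _ : ι => ν) +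
        ∑ B ∈ (W.powerset.filter (fun B => i ∈ B)).filter (fun B => j ∈ B),
          (∫ x, g (x i) * h (x j) * uR O x B ∂Measure.pi (fun _ : ι => ν)) * hcProb O ν (W \ B) := by
  have hgi : Measurable fun x : ι → X => g (x i) := hg.comp (measurable_pi_apply i)
  have hhj : Measurable fun x : ι → X => h (x j) := hh.comp (measurable_pi_apply j)
  have hpt : ∀ x : ι → X, g (x i) * h (x j) * efR O x W =
      ∑ B ∈ W.powerset.filter (fun B => i ∈ B), g (x i) * h (x j) * uR O x B * efR O x (W \ B) := by
    intro x
    rw [efR_eq_sum_uR_mul_efR x hi, mul_sum]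
    simp_rw [mul_assoc]
  simp_rw [hpt]
  have hintB : ∀ B ∈ W.powerset.filter (fun B => i ∈ B),
      Integrable (fun x : ι → X => g (x i) * h (x j) * uR O x B * efR O x (W \ B))
        (Measure.pi fun _ : ι => ν) := by
    intro B _
    refine integrable_pi_of_bounded ν
      (F := fun x => g (x i) * h (x j) * uR O x B * efR O x (W \ B))
      (((hgi.mul hhj).mul (measurable_uR hO B)).mul
      (measurable_efR hO _)) (C := |C| * |C'| * Literature.Probability.LatticeModels.hcUrsellBound B * 1) fun x => ?_
    rw [abs_mul, abs_mul, abs_mul]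
    refine mul_le_mul (mul_le_mul (mul_le_mul ((hgC _).trans (le_abs_self C))
      ((hhC _).trans (le_abs_self C')) (abs_nonneg _) (abs_nonneg _)) (abs_uR_le x B)
      (abs_nonneg _) (by positivity)) (abs_efR_le_one x _) (abs_nonneg _) (by positivity)
  rw [integral_finsetSum _ hintB, ← sum_filter_add_sum_filter_not _ (fun B => j ∉ B)]
  simp only [not_not]
  congr 1
  · refine sum_congr rfl fun B hB => ?_
    obtain ⟨hB, hjB⟩ := mem_filter.1 hB
    obtain ⟨hBW, hiB⟩ := mem_filter.1 hB
    have hdep1 : DependsOn (fun x : ι → X => g (x i) * uR O x B) (B : Set ι) := by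
      intro x y hxy
      have h2 : uR O x B = uR O y B := dependsOn_uR B hxy
      simp only
      rw [hxy i hiB, h2]
    have hdep2 : DependsOn (fun x : ι → X => h (x j) * efR O x (W \ B)) ((W \ B : Finset ι) : Set ι) := by
      intro x y hxy
      have h2 : efR O x (W \ B) = efR O y (W \ B) := dependsOn_efR _ hxy
      have hjWB : j ∈ W \ B := mem_sdiff.2 ⟨hj, hjB⟩
      simp only
      rw [hxy j hjWB, h2]
    have hfac := integral_mul_eq_of_dependsOn ν (disjoint_sdiff (s := B) (t := W))
      (F := fun x => g (x i) * uR O x B) (G := fun x => h (x j) * efR O x (W \ B))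
      (hgi.mul (measurable_uR hO B)) (hhj.mul (measurable_efR hO _)) hdep1 hdep2
    rw [decAct, ← hfac]
    exact integral_congr_ae (ae_of_all _ fun x => by ring)
  · refine sum_congr rfl fun B hB => ?_
    obtain ⟨hB, hjB⟩ := mem_filter.1 hB
    obtain ⟨hBW, hiB⟩ := mem_filter.1 hB
    have hdep1 : DependsOn (fun x : ι → X => g (x i) * h (x j) * uR O x B) (B : Set ι) := by
      intro x y hxy
      have h2 : uR O x B = uR O y B := dependsOn_uR B hxy
      simp only
      rw [hxy i hiB, hxy j hjB, h2]
    have hfac := integral_mul_eq_of_dependsOn ν (disjoint_sdiff (s := B) (t := W))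
      (F := fun x => g (x i) * h (x j) * uR O x B) (G := fun x => efR O x (W \ B))
      ((hgi.mul hhj).mul (measurable_uR hO B)) (measurable_efR hO _) hdep1 (dependsOn_efR _)
    rw [hfac, integral_efR ν hO]

/-! ### Relabelling symmetry -/

omit [Fintype ι] [MeasurableSpace X] in
/-- Relabelling a configuration by a permutation transports the Ursell weights. [folklore] -/
theorem uR_comp_perm (σ : Equiv.Perm ι) (x : ι → X) (B : Finset ι) :
    uR O (fun i => x (σ i)) B = uR O x (B.map σ.toEmbedding) := by
  unfold uR
  rw [Literature.Probability.LatticeModels.hcUrsell_map σ.toEmbedding (H := overlapRel O (fun i => x (σ i))) (H' := overlapRel O x)]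
  intro a b
  simp only [overlapRel, Equiv.coe_toEmbedding, σ.injective.ne_iff]

omit [Fintype ι] [MeasurableSpace X] in
/-- Relabelling transports the hard-core indicators. [folklore] -/
theorem efR_comp_perm (σ : Equiv.Perm ι) (x : ι → X) (W : Finset ι) :
    efR O (fun i => x (σ i)) W = efR O x (W.map σ.toEmbedding) := by
  unfold efR
  rw [Literature.Probability.LatticeModels.edgeFreeInd_map σ.toEmbedding (H := overlapRel O (fun i => x (σ i))) (H' := overlapRel O x)]
  intro a b
  simp only [overlapRel, Equiv.coe_toEmbedding, σ.injective.ne_iff]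

omit [DecidableEq ι] in
/-- The product measure is invariant under relabelling. [folklore] -/
theorem integral_comp_perm (σ : Equiv.Perm ι) {F : (ι → X) → ℝ}
    (hF : AEStronglyMeasurable F (Measure.pi fun _ : ι => ν)) :
    ∫ x, F (fun i => x (σ i)) ∂Measure.pi (fun _ : ι => ν) = ∫ x, F x ∂Measure.pi (fun _ : ι => ν) := by
  rw [← Measure.infinitePi_eq_pi] at hF ⊢
  exact Literature.Probability.LatticeModels.integral_comp_reindex_infinitePi ν σ hF

/-- `Ξ` is invariant under relabelling. [folklore] -/
theorem hcProb_map_perm (hO : MeasurableSet {p : X × X | O p.1 p.2}) (σ : Equiv.Perm ι) (W : Finset ι) :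
    hcProb O ν (W.map σ.toEmbedding) = hcProb O ν W := by
  rw [← integral_efR ν hO, ← integral_efR ν hO]
  simp_rw [← efR_comp_perm σ]
  exact integral_comp_perm ν σ (F := fun x => efR O x W) (measurable_efR hO W).aestronglyMeasurable

/-- The decorated activities are invariant under relabelling. [folklore] -/
theorem decAct_map_perm (hO : MeasurableSet {p : X × X | O p.1 p.2}) (σ : Equiv.Perm ι) {g : X → ℝ}
    (hg : Measurable g) (i : ι) (B : Finset ι) :
    decAct O ν g (σ i) (B.map σ.toEmbedding) = decAct O ν g i B := by
  unfold decAct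
  simp_rw [← uR_comp_perm σ]
  exact integral_comp_perm ν σ (F := fun x => g (x i) * uR O x B)
    ((hg.comp (measurable_pi_apply i)).mul (measurable_uR hO B)).aestronglyMeasurable

omit [Fintype ι] [DecidableEq ι] [MeasurableSpace X] in
/-- A permutation mapping `B` into itself fixes `B`. [folklore] -/
theorem map_perm_eq_of_forall_mem {σ : Equiv.Perm ι} {B : Finset ι} (h : ∀ b ∈ B, σ b ∈ B) :
    B.map σ.toEmbedding = B :=
  map_eq_of_subset fun b hb => by
    obtain ⟨a, ha, rfl⟩ := mem_map.1 hb
    exact h a ha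

/-- **Symmetry of `Ξ`**: `Ξ(W)` only depends on `#W`. [folklore] -/
theorem hcProb_eq_of_card_eq (hO : MeasurableSet {p : X × X | O p.1 p.2}) {W W' : Finset ι}
    (h : W.card = W'.card) : hcProb O ν W = hcProb O ν W' := by
  classical
  set e : {x // x ∈ W} ≃ {x // x ∈ W'} :=
    (W.equivFinOfCardEq h).trans (W'.equivFinOfCardEq rfl).symm with he
  set σ : Equiv.Perm ι := e.extendSubtype with hσ
  have hmap : W.map σ.toEmbedding = W' := by
    refine eq_of_subset_of_card_le (fun b hb => ?_) (by rw [card_map, h])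
    obtain ⟨a, ha, rfl⟩ := mem_map.1 hb
    exact e.extendSubtype_mem a ha
  rw [← hmap, hcProb_map_perm ν hO]

/-- The decorated activity does not depend on the marked label inside the block. [folklore] -/
theorem decAct_eq_of_mem (hO : MeasurableSet {p : X × X | O p.1 p.2}) {g : X → ℝ} (hg : Measurable g)
    {B : Finset ι} {i i' : ι} (hi : i ∈ B) (hi' : i' ∈ B) :
    decAct O ν g i B = decAct O ν g i' B := by
  set σ : Equiv.Perm ι := Equiv.swap i i'
  have hmap : B.map σ.toEmbedding = B := by
    refine map_perm_eq_of_forall_mem fun b hb => ?_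
    by_cases h1 : b = i
    · subst h1; rwa [Equiv.swap_apply_left]
    · by_cases h2 : b = i'
      · subst h2; rwa [Equiv.swap_apply_right]
      · rwa [Equiv.swap_apply_of_ne_of_ne h1 h2]
  rw [← decAct_map_perm ν hO σ hg i B, hmap, Equiv.swap_apply_left]

/-- **Symmetry of the decorated activities**: `w^g(B)` (marked at `i ∈ B`) only depends on `#B`.
[folklore] -/
theorem decAct_eq_of_card_eq (hO : MeasurableSet {p : X × X | O p.1 p.2}) {g : X → ℝ}
    (hg : Measurable g) {B B' : Finset ι} {i i' : ι} (hi : i ∈ B) (hi' : i' ∈ B')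
    (h : B.card = B'.card) : decAct O ν g i B = decAct O ν g i' B' := by
  classical
  set e : {x // x ∈ B} ≃ {x // x ∈ B'} :=
    (B.equivFinOfCardEq h).trans (B'.equivFinOfCardEq rfl).symm with he
  set σ : Equiv.Perm ι := e.extendSubtype with hσ
  have hmap : B.map σ.toEmbedding = B' := by
    refine eq_of_subset_of_card_le (fun b hb => ?_) (by rw [card_map, h])
    obtain ⟨a, ha, rfl⟩ := mem_map.1 hb
    exact e.extendSubtype_mem a ha
  have hσi : σ i ∈ B' := e.extendSubtype_mem i hi
  rw [← decAct_map_perm ν hO σ hg i B, hmap]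
  exact decAct_eq_of_mem ν hO hg hσi hi'

/-- The **decorated partition function** `M^g_i(W) = ∫ g(x_i) 𝟙[hardCoreSet W] dℙ`. [folklore] -/
noncomputable def decPF (O : X → X → Prop) (ν : Measure X) (g : X → ℝ) (i : ι) (W : Finset ι) : ℝ :=
  ∫ x, g (x i) * efR O x W ∂Measure.pi (fun _ : ι => ν)

/-- The decorated partition function is invariant under relabelling. [folklore] -/
theorem decPF_map_perm (hO : MeasurableSet {p : X × X | O p.1 p.2}) (σ : Equiv.Perm ι) {g : X → ℝ}
    (hg : Measurable g) (i : ι) (W : Finset ι) :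
    decPF O ν g (σ i) (W.map σ.toEmbedding) = decPF O ν g i W := by
  unfold decPF
  simp_rw [← efR_comp_perm σ]
  exact integral_comp_perm ν σ (F := fun x => g (x i) * efR O x W)
    ((hg.comp (measurable_pi_apply i)).mul (measurable_efR hO W)).aestronglyMeasurable

/-- The decorated partition function does not depend on the marked label inside `W`. [folklore] -/
theorem decPF_eq_of_mem (hO : MeasurableSet {p : X × X | O p.1 p.2}) {g : X → ℝ} (hg : Measurable g)
    {W : Finset ι} {i i' : ι} (hi : i ∈ W) (hi' : i' ∈ W) :
    decPF O ν g i W = decPF O ν g i' W := by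
  set σ : Equiv.Perm ι := Equiv.swap i i'
  have hmap : W.map σ.toEmbedding = W := by
    refine map_perm_eq_of_forall_mem fun b hb => ?_
    by_cases h1 : b = i
    · subst h1; rwa [Equiv.swap_apply_left]
    · by_cases h2 : b = i'
      · subst h2; rwa [Equiv.swap_apply_right]
      · rwa [Equiv.swap_apply_of_ne_of_ne h1 h2]
  rw [← decPF_map_perm ν hO σ hg i W, hmap, Equiv.swap_apply_left]

/-- **Symmetry of the decorated partition function**: `M^g_i(W)` (marked at `i ∈ W`) only depends
on `#W`. [folklore] -/
theorem decPF_eq_of_card_eq (hO : MeasurableSet {p : X × X | O p.1 p.2}) {g : X → ℝ}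
    (hg : Measurable g) {W W' : Finset ι} {i i' : ι} (hi : i ∈ W) (hi' : i' ∈ W')
    (h : W.card = W'.card) : decPF O ν g i W = decPF O ν g i' W' := by
  classical
  set e : {x // x ∈ W} ≃ {x // x ∈ W'} :=
    (W.equivFinOfCardEq h).trans (W'.equivFinOfCardEq rfl).symm with he
  set σ : Equiv.Perm ι := e.extendSubtype with hσ
  have hmap : W.map σ.toEmbedding = W' := by
    refine eq_of_subset_of_card_le (fun b hb => ?_) (by rw [card_map, h])
    obtain ⟨a, ha, rfl⟩ := mem_map.1 hb
    exact e.extendSubtype_mem a ha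
  have hσi : σ i ∈ W' := e.extendSubtype_mem i hi
  rw [← decPF_map_perm ν hO σ hg i W, hmap]
  exact decPF_eq_of_mem ν hO hg hσi hi'

/-! ### Adding one particle: the insertion lower bound -/

/-- **Insertion bound.** For `m ∉ W`, `Ξ(W ∪ {m}) ≥ Ξ(W) (1 - #W · p)`: conditionally on a
hard-core configuration of `W`, the extra point `x_m` must avoid the `#W` balls `{O (x_j) ·}`,
each of `ν`-measure `≤ p`. [folklore] -/
theorem hcProb_insert_ge (hO : MeasurableSet {p : X × X | O p.1 p.2})
    (hOs : ∀ a b, O a b → O b a) {p : ℝ} (hp0 : 0 ≤ p)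
    (hp : ∀ z, ν {y | O z y} ≤ ENNReal.ofReal p) {W : Finset ι} {m : ι} (hm : m ∉ W) :
    hcProb O ν W * (1 - W.card * p) ≤ hcProb O ν (insert m W) := by
  -- pointwise comparison of indicators
  have hpt : ∀ x : ι → X, efR O x W * (1 - ∑ j ∈ W, olap O (x j) (x m)) ≤ efR O x (insert m W) := by
    intro x
    by_cases hD' : x ∈ hardCoreSet O (insert m W)
    · rw [efR_eq_indicator x (insert m W), Set.indicator_of_mem hD']
      have h1 : efR O x W ≤ 1 := (le_abs_self _).trans (abs_efR_le_one x W)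
      have h2 : 0 ≤ ∑ j ∈ W, olap O (x j) (x m) := sum_nonneg fun j _ => olap_nonneg _ _
      have h3 := efR_nonneg (O := O) x W
      simp only [Pi.one_apply]
      nlinarith
    · rw [efR_eq_indicator x (insert m W), Set.indicator_of_notMem hD']
      by_cases hD : x ∈ hardCoreSet O W
      · -- some `j ∈ W` overlaps `m`
        have : ∃ j ∈ W, O (x j) (x m) := by
          by_contra hno
          push Not at hno
          refine hD' fun a ha b hb hab => ?_
          rcases mem_insert.1 ha with ha | ha
          · rcases mem_insert.1 hb with hb | hb
            · exact (hab (ha.trans hb.symm)).elim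
            · rw [ha]; exact fun h => hno b hb (hOs _ _ h)
          · rcases mem_insert.1 hb with hb | hb
            · rw [hb]; exact hno a ha
            · exact hD a ha b hb hab
        obtain ⟨j, hj, hO'⟩ := this
        have hge : 1 ≤ ∑ j ∈ W, olap O (x j) (x m) := by
          refine le_trans ?_ (single_le_sum (f := fun j => olap O (x j) (x m))
            (fun j _ => olap_nonneg _ _) hj)
          simp only [olap, if_pos hO', le_refl]
        have h3 := efR_nonneg (O := O) x W
        nlinarith
      · rw [efR_eq_indicator x W, Set.indicator_of_notMem hD, zero_mul]
  -- integrate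
  have hmeasW := measurable_efR (ι := ι) hO W
  have holm : ∀ j, Measurable fun x : ι → X => olap O (x j) (x m) := fun j =>
    measurable_olap_apply hO j m
  have hint_lhs : Integrable (fun x : ι → X => efR O x W * (1 - ∑ j ∈ W, olap O (x j) (x m))) (Measure.pi fun _ : ι => ν) :=
    integrable_pi_of_bounded ν (F := fun x => efR O x W * (1 - ∑ j ∈ W, olap O (x j) (x m)))
      (hmeasW.mul (measurable_const.sub (Finset.measurable_sum _ fun j _ => holm j)))
      (C := 1 * (1 + W.card)) fun x => by
        rw [abs_mul]
        refine mul_le_mul (abs_efR_le_one x W) ?_ (abs_nonneg _) zero_le_one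
        refine (abs_sub _ _).trans (add_le_add (by simp) ?_)
        rw [abs_of_nonneg (sum_nonneg fun j _ => olap_nonneg _ _)]
        calc ∑ j ∈ W, olap O (x j) (x m) ≤ ∑ _j ∈ W, (1 : ℝ) := sum_le_sum fun j _ => olap_le_one _ _
          _ = W.card := by simp
  have hint_rhs : Integrable (fun x : ι → X => efR O x (insert m W)) (Measure.pi fun _ : ι => ν) :=
    integrable_pi_of_bounded ν (measurable_efR hO _) (C := 1) fun x => abs_efR_le_one x _
  have hmain := integral_mono hint_lhs hint_rhs hpt
  rw [integral_efR ν hO] at hmain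
  refine le_trans ?_ hmain
  -- evaluate the left-hand side
  have hsplit : ∫ x, efR O x W * (1 - ∑ j ∈ W, olap O (x j) (x m)) ∂Measure.pi (fun _ : ι => ν) =
      hcProb O ν W - ∑ j ∈ W, ∫ x, efR O x W * olap O (x j) (x m) ∂Measure.pi (fun _ : ι => ν) := by
    have hint1 : Integrable (fun x : ι → X => efR O x W) (Measure.pi fun _ : ι => ν) :=
      integrable_pi_of_bounded ν hmeasW (C := 1) fun x => abs_efR_le_one x _
    have hint2 : ∀ j ∈ W, Integrable (fun x : ι → X => efR O x W * olap O (x j) (x m)) (Measure.pi fun _ : ι => ν) := by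
      intro j _
      exact integrable_pi_of_bounded ν (F := fun x => efR O x W * olap O (x j) (x m))
        (hmeasW.mul (holm j)) (C := 1 * 1) fun x => by
          rw [abs_mul]
          exact mul_le_mul (abs_efR_le_one x W) ((abs_of_nonneg (olap_nonneg _ _)).trans_le
            (olap_le_one _ _)) (abs_nonneg _) zero_le_one
    simp_rw [mul_sub, mul_one, mul_sum]
    rw [integral_sub hint1 (integrable_finsetSum _ hint2), integral_efR ν hO,
      integral_finsetSum _ hint2]
  rw [hsplit]
  -- each overlap integral is at most `p Ξ(W)`: integrate out `x m`
  have hterm : ∀ j ∈ W, ∫ x, efR O x W * olap O (x j) (x m) ∂Measure.pi (fun _ : ι => ν) ≤ p * hcProb O ν W := by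
    intro j hj
    have hjm : j ≠ m := fun h => hm (h ▸ hj)
    have hint : Integrable (fun x : ι → X => efR O x W * olap O (x j) (x m)) (Measure.pi fun _ : ι => ν) :=
      integrable_pi_of_bounded ν (F := fun x => efR O x W * olap O (x j) (x m))
        (hmeasW.mul (holm j)) (C := 1 * 1) fun x => by
          rw [abs_mul]
          exact mul_le_mul (abs_efR_le_one x W) ((abs_of_nonneg (olap_nonneg _ _)).trans_le
            (olap_le_one _ _)) (abs_nonneg _) zero_le_one
    have hupd := Literature.Probability.LatticeModels.integral_infinitePi_eq_integral_update (fun _ : ι => ν) m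
      (F := fun x => efR O x W * olap O (x j) (x m)) (by rwa [Measure.infinitePi_eq_pi])
    rw [Measure.infinitePi_eq_pi] at hupd
    rw [hupd]
    have hinner : ∀ x : ι → X, ∫ y, efR O (Function.update x m y) W *
        olap O (Function.update x m y j) (Function.update x m y m) ∂ν =
        efR O x W * (ν.real {y | O (x j) y}) := by
      intro x
      have h1 : ∀ y, efR O (Function.update x m y) W = efR O x W := fun y =>
        dependsOn_efR W fun i hi => Function.update_of_ne (ne_of_mem_of_not_mem (mem_coe.1 hi) hm) _ _
      simp_rw [h1, Function.update_self, Function.update_of_ne hjm, integral_const_mul]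
      congr 1
      rw [olap_eq_indicator_right, integral_indicator_one (measurableSet_olap_right hO _)]
    simp_rw [hinner]
    have hbound : ∀ x : ι → X, efR O x W * ν.real {y | O (x j) y} ≤ efR O x W * p := fun x =>
      mul_le_mul_of_nonneg_left (ENNReal.toReal_le_of_le_ofReal hp0 (hp _)) (efR_nonneg x W)
    have hint1 : Integrable (fun x : ι → X => efR O x W * ν.real {y | O (x j) y}) (Measure.pi fun _ : ι => ν) := by
      have : (fun x : ι → X => efR O x W * ν.real {y | O (x j) y}) =
          fun x => ∫ y, efR O (Function.update x m y) W *
            olap O (Function.update x m y j) (Function.update x m y m) ∂ν := funext fun x => (hinner x).symm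
      rw [this]
      have h2 := hint
      rw [← Measure.infinitePi_eq_pi (μ := fun _ : ι => ν)] at h2
      have h3 := (integrable_map_measure (μ := (Measure.infinitePi fun _ : ι => ν).prod ν)
        (f := fun q : (ι → X) × X => Function.update q.1 m q.2)
        (g := fun x => efR O x W * olap O (x j) (x m)) ?_ measurable_update'.aemeasurable).1 ?_
      · rw [Measure.infinitePi_eq_pi] at h3
        exact h3.integral_prod_left
      · rw [Literature.Probability.LatticeModels.map_update_infinitePi_prod]; exact h2.aestronglyMeasurable
      · rw [Literature.Probability.LatticeModels.map_update_infinitePi_prod]; exact h2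
    have hint2 : Integrable (fun x : ι → X => efR O x W * p) (Measure.pi fun _ : ι => ν) :=
      (integrable_pi_of_bounded ν hmeasW (C := 1) fun x => abs_efR_le_one x _).mul_const p
    calc ∫ x, efR O x W * ν.real {y | O (x j) y} ∂Measure.pi (fun _ : ι => ν) ≤ ∫ x, efR O x W * p ∂Measure.pi (fun _ : ι => ν) :=
          integral_mono hint1 hint2 hbound
      _ = p * hcProb O ν W := by rw [integral_mul_const, integral_efR ν hO, mul_comm]
  have hsum : ∑ j ∈ W, ∫ x, efR O x W * olap O (x j) (x m) ∂Measure.pi (fun _ : ι => ν) ≤ W.card * (p * hcProb O ν W) := by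
    calc ∑ j ∈ W, ∫ x, efR O x W * olap O (x j) (x m) ∂Measure.pi (fun _ : ι => ν) ≤ ∑ _j ∈ W, p * hcProb O ν W :=
          sum_le_sum hterm
      _ = W.card * (p * hcProb O ν W) := by rw [sum_const, nsmul_eq_mul]
  nlinarith [hsum]

omit [DecidableEq ι] in
/-- `Ξ` is monotone decreasing in the label set. [folklore] -/
theorem hcProb_mono {W W' : Finset ι} (h : W ⊆ W') : hcProb O ν W' ≤ hcProb O ν W := by
  unfold hcProb
  exact measureReal_mono (fun x hx i hi j hj hij => hx i (h hi) j (h hj) hij)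

omit [DecidableEq ι] [IsProbabilityMeasure ν] in
/-- `0 ≤ Ξ`. [folklore] -/
theorem hcProb_nonneg (W : Finset ι) : 0 ≤ hcProb O ν W := measureReal_nonneg

omit [DecidableEq ι] in
/-- `Ξ ≤ 1`. [folklore] -/
theorem hcProb_le_one (W : Finset ι) : hcProb O ν W ≤ 1 := by
  unfold hcProb
  exact (measureReal_mono (Set.subset_univ _)).trans (by simp)

end HardCoreCanonical


end Literature.MathematicalPhysics.StatisticalMechanics
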